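import Summits.BirchSwinnertonDyer.Rank1Residual.Additive.QuadraticBranchPlusEtaNodes
import Summits.BirchSwinnertonDyer.Rank1Residual.Additive.QuadraticBranchEvenControlZero
import Summits.BirchSwinnertonDyer.Rank1Residual.Additive.QuadraticBranchEvenValueIdentity
import Summits.BirchSwinnertonDyer.Rank1Residual.Additive.SignedTwistPlusDualTransport
import Summits.BirchSwinnertonDyer.Rank1Residual.Additive.QuadraticTwistTypeG
import Summits.BirchSwinnertonDyer.Rank1Residual.Additive.CyclotomicQuadraticSubfield
import Summits.BirchSwinnertonDyer.Rank1Residual.Additive.SignedTwistLocalGalois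
import Summits.BirchSwinnertonDyer.Rank1Residual.Additive.ChiEigenPrimeToPDescentGenerator
import Summits.BirchSwinnertonDyer.Rank1Residual.Additive.CyclotomicTowerSignedSelmerDual
import Summits.BirchSwinnertonDyer.BirchSwinnertonDyer.Theorems.QuadraticBranchSignedControlEtaTransportCharacter
import Literature.NumberTheory.EllipticCurves.KitajimaOtsuki2018.EtaSelmerNoFiniteSubmodule
import Literature.NumberTheory.EllipticCurves.LeadingTermPPartProofs
import Literature.NumberTheory.EllipticCurves.Wuthrich2014.ShaBoundProofs
import HarnessLib

/-!
# Route `QuadraticBranchSignedControl` (rung K8, cell `bsd-potss`), crux `PlusEtaLowerInclusion`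
# (item stmt-BirchSwinnertonDyer-19601): (E⁺_η) at a tower-onto Gss2 pair of ANALYTIC RANK ZERO from
# the LOWER `p`-part of BSD for the additive twist `W` (tool theorems for the BC5 rung
# `stub_etaLower_rung_39675m1` and for every unit-Kurihara-number row of Gss2)

WHAT. The crux 19601 is the Eisenstein inclusion `Char(X⁺(V/K_∞)^η) ⊆ (L_p⁺(V, η, X))` of
Kobayashi's even main conjecture at `η = ω^{(p−1)/2}` (node `QuadraticBranchPlusEtaLowerInclusionAt`,
print currency) on the tower-onto good supersingular `a_p = 0` twists `V` of the Gss2 partners `W`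
(`C • W^{(p*)} = V`). THIS FILE proves, for every ODD `p` and every such pair with `L(W,1) ≠ 0`:

  (Kob03 Thm. 2.2 / Thm. 4.1 at `η` + Kitajima–Otsuki Thm. 1.3 + modularity — NAMED facts)
  + `ρ_{V,p^∞}` onto + the LOWER `p`-PART OF BSD FOR `W` in Kim's OUTPUT SHAPE
    («`L(W,1)/Ω_W = q ∈ ℚ` with `v_p(q) ≤ ord_p #Sel_{p^∞}(W/ℚ)`», resp. `≤ ord_p #Ш(W)(p)` + GZK)
  ⟹ (E⁺_η)(V, p), and hence Kobayashi's even main conjecture (C1⁺_η) at the pair.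

Chain (every brick is a landed tree theorem; the new items are §1–§2):
* Kato side (Thm. 4.1 at `η`, `n = 0` since the tower is onto; Thm. 2.2 at `η`):
  `(Lη) ⊆ Char(D.X) = (g)`, i.e. `g ∣ Lη` (`EtaSignedSelmerDualData.thm41_plus_of_facts`);
* ctrl's VALUE IDENTITY `v_p(Lη(0)) = v_p(L(W,1)/Ω_W)` (`valuation_constantCoeff_eq_padicValRat_of_twist`,
  Kobayashi (3.6) + Birch + Pal; `L(W,1) ≠ 0 ⟹ Lη(0) ≠ 0`);
* a `W`-coordinate plus dual datum `D_W` of `Sel⁺(W/ℚ_∞)` moved to an `η`-datum `D'` of `V` with the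
  SAME module ((D5⁺) `SignedTwist.exists_etaSignedSelmerDualData_one`), and §2's uniqueness
  `D.X ≃ₗ[Λ] D'.X` (any two `η`-data are `Λ`-isomorphic), so `Char(D_W.X) = Char(D.X) = (g)`;
  Kitajima–Otsuki at `η` (named fact, on `D'`) gives "no finite submodule" for `D_W`;
* ctrl's even bottom-layer control `EvenControlZero.finite_and_padicValNat_card_selmerGroupPInfty_le_…`:
  `ord_p #Sel_{p^∞}(W/ℚ) ≤ v_p(g(0))` (Kobayashi Thm. 9.3 / Greenberg Lemma 4.2, in the tree);
* §1: in `Λ = ℤ_p⟦T⟧`, `g ∣ L`, `L(0) ≠ 0`, `v_p(L(0)) ≤ v_p(g(0))` force `(g) = (L)`.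
So `v_p(Lη(0)) = v_p(q) ≤ ord_p #Sel ≤ v_p(g(0))` and `(g) = (Lη)`: (E⁺_η) — indeed (C1⁺_η) — at the pair.

* §3 `quadraticBranchPlusEtaLowerInclusionAt_of_namedFacts_of_selmerWitness` (Selmer shape),
  `…_of_shaWitness` (Kim's `Ш`-shape + GZK), and the (C1⁺_η) versions.
* The BC5 rung `stub_etaLower_rung_39675m1` of the birth skeleton of 19601 (`W₀ = 39675m1`, `p = 5`) is
  the instance of §3 landed in the sibling file
  `Theorems/QuadraticBranchSignedControlPlusEtaLowerInclusionRung39675m1.lean`.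

WHAT THIS MEANS / IS NOT. On the tower-onto rows with `r_an(W) = 0` the crux 19601 (= Kato's lower inclusion
for the additive twist `W ⊗ χ_{p*}` on the `η`-component, open class-wide) FOLLOWS from the lower
`p`-part of BSD for `W` — the converse of ctrl's T-e2-r0 (`(C1_η) ⟹ BSD(W,p)`); so per pair it is
delivered by ONE unit Kurihara number (Kim 2026 Thm. 1.8 (6)). Rows with `L(W,1) = 0` (`Lη(0) = 0`) are
NOT touched: there the constant-term squeeze says nothing (one needs the leading coefficient).

HONEST FRAMING (cell `bsd-potss`, run/shared/lean/pub/bsd-potss/; FULL-BSD rank ≤ 1 programme,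
HUMAN RULING D-0036/D-0074/D-0088(2)): TOOL THEOREMS ONLY. Every statement is
CONDITIONAL on named Literature facts in hypothesis position (Kobayashi 2003 Thm. 2.2 / 4.1 at `η`,
Kitajima–Otsuki 2018 Thm. 1.3, modularity, and for the `Ш`-shape GZK) and on DISPLAYED per-pair inputs
(`L(W,1) ≠ 0` and the lower `p`-part witness — a Kurihara-number COMPUTATION read through Kim's
theorem, NOT proved here). The crux 19601 is NOT closed; nothing
is booked; no label / mark / count moves; `BSD(W, p)` is claimed for no pair; no definition, no named
fact minted, no `sorry`, axioms standard. Seat `bsd-potss-k8-rung` (prover), g0;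
`--supports stmt-BirchSwinnertonDyer-19601` (ACCEL-LIST (5), director-bsd PART 1b).

References: [Kobayashi2003] Thm. 2.2 (p. 5), §3 + (3.6) (pp. 5–7), §4 Even main conjecture + Thm. 4.1
(p. 8), Lemma 9.1 / Thm. 9.3 (pp. 25–27); [KitajimaOtsuki2018] Main Thm. 1.3; [GreenbergLNM1716] §1
(p. 60), §4 Lemma 4.2 (p. 102); [Kim2022StructureSelmer] Thm. 1.8 (6) (journal) = Thm. 1.9 (arXiv v4);
[Washington1997] §13.2; [MazurTateTeitelbaum1986Invent] §I.8 (8.6).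
-/

set_option autoImplicit false
set_option linter.dupNamespace false

noncomputable section

open scoped Classical

open CongruenceSubgroup Field WeierstrassCurve
open Literature.NumberTheory.EllipticCurves
open Literature.NumberTheory.EllipticCurves.ModularForms
open Literature.NumberTheory.GaloisRepresentations
open Literature.NumberTheory.EllipticCurves.IwasawaDual
open Summit.BirchSwinnertonDyer.Rank1Residual.Additive
open Summit.BirchSwinnertonDyer.Rank1Residual.Additive.SignedTwist
open Summit.BirchSwinnertonDyer.Rank1Residual.AdditivePotMult

namespace Summit.BirchSwinnertonDyer.BirchSwinnertonDyer.Theorems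

/-! ## §1 `Λ`-algebra: a divisor with the right constant term generates the same ideal -/

section Algebra

variable {p : ℕ} [hp : Fact p.Prime]

/-- In `Λ = ℤ_p⟦T⟧`: if `g ∣ L`, `L(0) ≠ 0` and `v_p(L(0)) ≤ v_p(g(0))`, then `(g) = (L)` — write
`L = g·h`; then `v_p(h(0)) = v_p(L(0)) − v_p(g(0)) ≤ 0`, so `h(0) ∈ ℤ_p^×` and `h ∈ Λ^×`.
[cite: Washington1997, §13.2 (Λ = ℤ_p⟦T⟧; a power series is a unit iff its constant term is)] -/
theorem span_singleton_eq_of_dvd_of_valuation_le {g L : IwasawaAlgebra p} (hdvd : g ∣ L)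
    (hL0 : PowerSeries.constantCoeff L ≠ 0)
    (hle : ((PowerSeries.constantCoeff L : ℤ_[p]) : ℚ_[p]).valuation ≤
      ((PowerSeries.constantCoeff g : ℤ_[p]) : ℚ_[p]).valuation) :
    Ideal.span {g} = Ideal.span {L} := by
  obtain ⟨h, rfl⟩ := hdvd
  have hmul : PowerSeries.constantCoeff (g * h) =
      PowerSeries.constantCoeff g * PowerSeries.constantCoeff h := map_mul _ _ _
  have hg0 : PowerSeries.constantCoeff g ≠ 0 := fun h0 => hL0 (by rw [hmul, h0, zero_mul])
  have hh0 : PowerSeries.constantCoeff h ≠ 0 := fun h0 => hL0 (by rw [hmul, h0, mul_zero])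
  -- valuations in `ℤ_p`
  have hval : (PowerSeries.constantCoeff (g * h)).valuation =
      (PowerSeries.constantCoeff g).valuation + (PowerSeries.constantCoeff h).valuation := by
    rw [hmul, PadicInt.valuation_mul hg0 hh0]
  have hle' : (PowerSeries.constantCoeff (g * h)).valuation ≤
      (PowerSeries.constantCoeff g).valuation := by
    rw [PadicInt.valuation_coe, PadicInt.valuation_coe] at hle
    exact_mod_cast hle
  have hh : (PowerSeries.constantCoeff h).valuation = 0 := by
    rw [hval] at hle'
    omega
  -- `h(0)` is a unit of `ℤ_p`, so `h` is a unit of `Λ`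
  have hunit0 : IsUnit (PowerSeries.constantCoeff h) := by
    rw [PadicInt.isUnit_iff]
    have h1 := PadicInt.norm_eq_zpow_neg_valuation hh0
    rw [hh] at h1
    simpa using h1
  have hunit : IsUnit h := PowerSeries.isUnit_iff_constantCoeff.mpr hunit0
  exact (Ideal.span_singleton_mul_right_unit hunit g).symm

end Algebra

/-! ## §2 Any two Pontryagin-dual data for the same `(S, ψ)` are `Λ`-isomorphic -/

section Unique

variable {p : ℕ} [Fact p.Prime] {S : Type*} [AddCommGroup S] {ψ : AddMonoid.End S}
  {X : Type*} [AddCommGroup X] [Module (IwasawaAlgebra p) X]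
  {X' : Type*} [AddCommGroup X'] [Module (IwasawaAlgebra p) X']
  {toDual : X →+ (S →+ AddCircle (1 : ℚ))} {toDual' : X' →+ (S →+ AddCircle (1 : ℚ))}

/-- Induction carrier: on `s` killed by `ψ^N` the `Λ`-action of ANY dual pair read through `toDual`
is the canonical `IsLocNil.smulFun` (peel off the constant term, `f = T·g + C(a)`; the axioms
`T_smul` / `C_smul`). Abstract form of the tree's `SelmerDualData.toDual_smul_apply_of_pow_apply_eq_zero`.
[cite: GreenbergLNM1716, §1 (p. 60)] -/
theorem isDualPair_toDual_smul_apply_of_pow_apply_eq_zero (h : IsDualPair p ψ toDual) (N : ℕ) :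
    ∀ (s : S), (ψ ^ N) s = 0 → ∀ (f : IwasawaAlgebra p) (x : X),
      toDual (f • x) s = h.locNil.smulFun f (toDual x) s := by
  induction N with
  | zero =>
    intro s hs f x
    rw [pow_zero, AddMonoid.End.one_apply] at hs
    rw [hs, map_zero, map_zero]
  | succ N ih =>
    intro s hs f x
    obtain ⟨k, hk⟩ := h.locNil.torsion s
    have hψs : (ψ ^ N) (ψ s) = 0 := by
      rwa [pow_succ, AddMonoid.End.coe_mul, Function.comp_apply] at hs
    set g : IwasawaAlgebra p := PowerSeries.mk fun n ↦ PowerSeries.coeff (n + 1) f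
    set a : ℤ_[p] := PowerSeries.constantCoeff f
    have hf : f = PowerSeries.X * g + PowerSeries.C a := PowerSeries.eq_X_mul_shift_add_const f
    have lhs : toDual (f • x) s =
        toDual (g • x) (ψ s) + (PadicInt.toZModPow k a).val • toDual x s := by
      conv_lhs => rw [hf]
      rw [add_smul, mul_smul, map_add, AddMonoidHom.add_apply, h.T_smul, h.C_smul a x s k hk]
    have rhs : h.locNil.smulFun f (toDual x) s =
        h.locNil.smulFun g (toDual x) (ψ s) + (PadicInt.toZModPow k a).val • toDual x s := by
      conv_lhs => rw [hf]
      rw [h.locNil.smulFun_add_left, h.locNil.smulFun_mul_left, AddMonoidHom.add_apply,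
        h.locNil.smulFun_X_apply, h.locNil.smulFun_C_apply a (toDual x) hk]
    rw [lhs, rhs, ih (ψ s) hψs g x]

/-- **The `Λ`-action of a dual pair is forced**: `toDual (f • x) = f ⋆ toDual x` with `⋆` the
canonical action `IsLocNil.smulFun` of `ψ`. [cite: GreenbergLNM1716, §1 (p. 60)] -/
theorem isDualPair_toDual_smul (h : IsDualPair p ψ toDual) (f : IwasawaAlgebra p) (x : X) :
    toDual (f • x) = h.locNil.smulFun f (toDual x) := by
  ext s
  obtain ⟨N, hN⟩ := h.locNil.nil s
  exact isDualPair_toDual_smul_apply_of_pow_apply_eq_zero h N s hN f x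

/-- **Uniqueness of the Pontryagin dual as a `Λ`-module**: two dual pairs `(X, toDual)`,
`(X', toDual')` for the SAME `(S, ψ)` have `Λ`-isomorphic modules, by `toDual'⁻¹ ∘ toDual`
(a group isomorphism, `Λ`-linear since both actions are the canonical one). Abstract form of the
tree's `SelmerDualData.exists_linearEquiv` / `Kobayashi2003.SignedSelmerDualData.exists_linearEquiv`.
[cite: GreenbergLNM1716, §1 (p. 60)] -/
theorem isDualPair_exists_linearEquiv (h : IsDualPair p ψ toDual) (h' : IsDualPair p ψ toDual') :
    ∃ e : X ≃ₗ[IwasawaAlgebra p] X', ∀ x, toDual' (e x) = toDual x := by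
  refine ⟨{ toFun := fun x ↦ (AddEquiv.ofBijective toDual' h'.bijective).symm (toDual x)
            invFun := fun x' ↦ (AddEquiv.ofBijective toDual h.bijective).symm (toDual' x')
            map_add' := fun x y ↦ by rw [map_add, map_add]
            map_smul' := fun f x ↦ ?_
            left_inv := fun x ↦ ?_
            right_inv := fun x' ↦ ?_ }, fun x ↦ ?_⟩
  · apply h'.bijective.injective
    have e1 : toDual' ((AddEquiv.ofBijective toDual' h'.bijective).symm (toDual (f • x))) =
        toDual (f • x) :=
      (AddEquiv.ofBijective toDual' h'.bijective).apply_symm_apply _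
    have e2 : toDual' ((AddEquiv.ofBijective toDual' h'.bijective).symm (toDual x)) = toDual x :=
      (AddEquiv.ofBijective toDual' h'.bijective).apply_symm_apply _
    rw [RingHom.id_apply, e1, isDualPair_toDual_smul h', e2, isDualPair_toDual_smul h]
  · apply h.bijective.injective
    have e1 : toDual ((AddEquiv.ofBijective toDual h.bijective).symm
        (toDual' ((AddEquiv.ofBijective toDual' h'.bijective).symm (toDual x)))) =
        toDual' ((AddEquiv.ofBijective toDual' h'.bijective).symm (toDual x)) :=
      (AddEquiv.ofBijective toDual h.bijective).apply_symm_apply _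
    have e2 : toDual' ((AddEquiv.ofBijective toDual' h'.bijective).symm (toDual x)) = toDual x :=
      (AddEquiv.ofBijective toDual' h'.bijective).apply_symm_apply _
    exact e1.trans e2
  · apply h'.bijective.injective
    have e1 : toDual' ((AddEquiv.ofBijective toDual' h'.bijective).symm
        (toDual ((AddEquiv.ofBijective toDual h.bijective).symm (toDual' x')))) =
        toDual ((AddEquiv.ofBijective toDual h.bijective).symm (toDual' x')) :=
      (AddEquiv.ofBijective toDual' h'.bijective).apply_symm_apply _
    have e2 : toDual ((AddEquiv.ofBijective toDual h.bijective).symm (toDual' x')) = toDual' x' :=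
      (AddEquiv.ofBijective toDual h.bijective).apply_symm_apply _
    exact e1.trans e2
  · exact (AddEquiv.ofBijective toDual' h'.bijective).apply_symm_apply _

end Unique

/-! ## §3 (E⁺_η) at a tower-onto rank-zero pair from the lower `p`-part of BSD for `W` -/

section Pair

variable {V : WeierstrassCurve ℚ} [V.IsElliptic] [V.IsGloballyMinimal] {p : ℕ} [hp : Fact p.Prime]

/-- **(E⁺_η) — the content of crux 19601 — AT A TOWER-ONTO PAIR OF ANALYTIC RANK ZERO, from the
lower `p`-part of BSD for the additive twist (Selmer shape).** Hypotheses: the NAMED facts Kobayashi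
Thm. 2.2 at `η` (`h22`), Thm. 4.1 at `η` (`h41`), Kitajima–Otsuki Thm. 1.3 (`hKO`), modularity
(`hmod`); the Gss2 partner `W` (globally minimal, `C • W^{(p*)} = V`); `ρ_{V,p^m}` onto for all `m`;
`L(W,1) ≠ 0`; and the witness «`L(W,1)/Ω_W = q ∈ ℚ`, `v_p(q) ≤ ord_p #Sel_{p^∞}(W/ℚ)`» (the lower
`p`-part of BSD for `W` up to the units `Tam(W)`, `#W(ℚ)_tors`; per pair it is Kim's Thm. 1.8 (6) on
a unit Kurihara number). Conclusion: `QuadraticBranchPlusEtaLowerInclusionAt V p`, every odd `p`. See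
the module docstring for the chain. CONDITIONAL on the displayed inputs; closes nothing class-wide.
[cite: Kobayashi2003, Thm. 2.2 (p. 5), (3.6) (p. 7), §4 + Thm. 4.1 (p. 8), Thm. 9.3 (p. 26)]
[cite: KitajimaOtsuki2018, Main Thm. 1.3] [cite: GreenbergLNM1716, §1 (p. 60), §4 Lemma 4.2 (p. 102)] -/
theorem quadraticBranchPlusEtaLowerInclusionAt_of_namedFacts_of_selmerWitness
    (h22 : Kobayashi2003.thm22_etaSignedSelmerDual_finite_torsion)
    (h41 : Kobayashi2003.thm41_plusEtaCharIdeal_dvd)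
    (hKO : KitajimaOtsuki2018.mainThm13_etaSignedSelmerDual_noFiniteSubmodule)
    (hmod : hasEntireLFunction_rat)
    (W : WeierstrassCurve ℚ) [W.IsElliptic] [W.IsGloballyMinimal] (C : VariableChange ℚ)
    (hCV : C • W.quadraticTwist ((-1) ^ (p / 2) * p) = V)
    (hsurj : ∀ m : ℕ, V.HasSurjectiveModNGaloisRep (p ^ m : ℕ))
    (hLW : W.entireLFunction 1 ≠ 0)
    (hwit : ∃ q : ℚ, W.entireLFunction 1 / (W.realPeriodRat : ℂ) = (q : ℂ) ∧
      padicValRat p q ≤ (padicValNat p (Nat.card ↥(W.selmerGroupPInfty p)) : ℤ)) :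
    QuadraticBranchPlusEtaLowerInclusionAt V p := by
  intro K₀ _ _ _ _ ηq hηK hη1 N _ f hp2 hgood hap hf ϖ hϖ Lη hL κ γ hκ hγ hγK hγc D
  -- Thm. 2.2 at `η`: `D.X` is finitely generated torsion; a characteristic power series `g`
  obtain ⟨hfin, htor⟩ :=
    EtaSignedSelmerDualData.finite_isTorsion_of_thm22 h22 hηK hp2 hgood hap hκ hγ hγK D
  haveI : Module.Finite (IwasawaAlgebra p) D.X := hfin
  obtain ⟨g, hg⟩ := (charIdeal_isPrincipal_holds p D.X).principal
  have hg' : D.charIdeal = Ideal.span {g} := hg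
  -- the Kato side (Thm. 4.1 at `η`, `n = 0` on the tower-onto locus): `g ∣ Lη`
  obtain ⟨-, hup⟩ := EtaSignedSelmerDualData.thm41_plus_of_facts h22 h41 hηK hη1 hp2 hgood hap hf
    ϖ hϖ Lη hL hκ hγ hγK hγc D
  have hgL : g ∣ Lη := by
    have h := hup hsurj
    rw [hg', Ideal.span_singleton_le_span_singleton] at h
    exact h
  -- the value identity: `v_p(Lη(0)) = v_p(q)`, `Lη(0) ≠ 0`
  obtain ⟨q, hq, hqle⟩ := hwit
  obtain ⟨hval, hne⟩ :=
    valuation_constantCoeff_eq_padicValRat_of_twist p hmod hp2 W V C hCV hgood hf hϖ hL hq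
  have hL0 : PowerSeries.constantCoeff Lη ≠ 0 := hne hLW
  have hg0 : PowerSeries.constantCoeff g ≠ 0 := by
    obtain ⟨h, hh⟩ := hgL
    intro h0
    apply hL0
    rw [hh, map_mul, h0, zero_mul]
  -- a `W`-coordinate plus dual datum and its transport to an `η`-datum at `γ`
  obtain ⟨DW⟩ := nonempty_strictSignedSelmerDualData W κ ℚ_[p] 1 hγ
  obtain ⟨θ₀, hθ₀2⟩ := exists_sq_eq_pStar p K₀ hp2
  have hc₀ : θ₀ ^ 2 = algebraMap ℚ K₀ ((-1) ^ (p / 2) * p) := by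
    rw [hθ₀2, map_mul, map_pow, map_neg, map_one, map_natCast]
  have hθ₀ : θ₀ ∉ Set.range (algebraMap ℚ K₀) := by
    rintro ⟨r, hr⟩
    apply forall_sq_ne_pStar p r
    apply (algebraMap ℚ K₀).injective
    rw [map_pow, hr, hc₀]
  have hη : ∀ σ, ηq σ = 1 ↔ σ • rootInClosure K₀ θ₀ = rootInClosure K₀ θ₀ :=
    eta_eq_one_iff_smul_rootInClosure p K₀ hθ₀ hc₀ ηq hηK hη1
  have hDK := localTowerHyp_padic p κ K₀ hκ
  have hκ₀ : ∀ x, ∃ g ∈ galRange (K := ℚ) K₀, κ g = x := kappa_surjOn_galRange_cyclotomic κ K₀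
  have hcop : (galRange (K := ℚ) K₀).index.Coprime p := coprime_index_galRange_cyclotomic p K₀
  have hγγ : γ⁻¹ * γ ∈ κ.kerSubgroup := by rw [inv_mul_cancel]; exact one_mem _
  obtain ⟨D', hfin', htor', hchar', hnf'⟩ :=
    exists_etaSignedSelmerDualData_one W K₀ hθ₀ hc₀ p κ hCV ηq hη ℚ_[p] hDK hκ₀ hcop hγK hγγ DW
  -- Thm. 2.2 at `η` for `D'`; Kitajima–Otsuki for `D'`; both transported to `DW`
  obtain ⟨hfinD', htorD'⟩ :=
    EtaSignedSelmerDualData.finite_isTorsion_of_thm22 h22 hηK hp2 hgood hap hκ hγ hγK D'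
  haveI : Module.Finite (IwasawaAlgebra p) DW.X := hfin'.mp hfinD'
  have htorW : Module.IsTorsion (IwasawaAlgebra p) DW.X := htor'.mp htorD'
  have hnfW : ∀ M : Submodule (IwasawaAlgebra p) DW.X, Finite M → M = ⊥ :=
    hnf'.mp (hKO p K₀ ηq hηK V hp2 hgood hap κ γ hκ hγ hγK 1 D'.toLiterature hfinD' htorD')
  -- uniqueness: `D.X ≃ₗ[Λ] D'.X`, so `Char(DW.X) = Char(D'.X) = Char(D.X) = (g)`
  obtain ⟨e, -⟩ := isDualPair_exists_linearEquiv
    (EtaSignedSelmerDualData.isDualPair V κ K₀ ℚ_[p] ηq 1 D hκ₀ hγ hγK)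
    (EtaSignedSelmerDualData.isDualPair V κ K₀ ℚ_[p] ηq 1 D' hκ₀ hγ hγK)
  have hcharW : DW.charIdeal = Ideal.span {g} := by
    rw [← hchar', ← hg']
    exact (Module.charIdeal_eq_of_linearEquiv e).symm
  -- even bottom-layer control: `ord_p #Sel_{p^∞}(W/ℚ) ≤ v_p(g(0))`
  obtain ⟨-, hSel⟩ :=
    EvenControlZero.finite_and_padicValNat_card_selmerGroupPInfty_le_of_quadraticTwist_signedPrime W κ
      hp2 C V hCV hgood hap hγ DW htorW hnfW hcharW hg0
  -- squeeze
  have hle : ((PowerSeries.constantCoeff Lη : ℤ_[p]) : ℚ_[p]).valuation ≤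
      ((PowerSeries.constantCoeff g : ℤ_[p]) : ℚ_[p]).valuation := by
    rw [hval]
    exact hqle.trans hSel
  rw [hg', span_singleton_eq_of_dvd_of_valuation_le hgL hL0 hle]

/-- **(C1⁺_η) — Kobayashi's even main conjecture at `η` VERBATIM — at a tower-onto rank-zero pair
from the same inputs** (Thm. 2.2 / 4.1 at `η` supply finiteness and `⊇`; the previous theorem `⊆`).
CONDITIONAL; closes nothing class-wide. [cite: Kobayashi2003, Thm. 2.2 (p. 5), §4 Even main conjecture + Thm. 4.1 (p. 8)] -/
theorem quadraticBranchPlusEtaMainConjectureAt_of_namedFacts_of_selmerWitness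
    (h22 : Kobayashi2003.thm22_etaSignedSelmerDual_finite_torsion)
    (h41 : Kobayashi2003.thm41_plusEtaCharIdeal_dvd)
    (hKO : KitajimaOtsuki2018.mainThm13_etaSignedSelmerDual_noFiniteSubmodule)
    (hmod : hasEntireLFunction_rat)
    (W : WeierstrassCurve ℚ) [W.IsElliptic] [W.IsGloballyMinimal] (C : VariableChange ℚ)
    (hCV : C • W.quadraticTwist ((-1) ^ (p / 2) * p) = V)
    (hsurj : ∀ m : ℕ, V.HasSurjectiveModNGaloisRep (p ^ m : ℕ))
    (hLW : W.entireLFunction 1 ≠ 0)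
    (hwit : ∃ q : ℚ, W.entireLFunction 1 / (W.realPeriodRat : ℂ) = (q : ℂ) ∧
      padicValRat p q ≤ (padicValNat p (Nat.card ↥(W.selmerGroupPInfty p)) : ℤ)) :
    QuadraticBranchPlusEtaMainConjectureAt V p :=
  quadraticBranchPlusEtaMainConjectureAt_of_facts_of_surjective_of_etaLowerInclusion h22 h41 hsurj
    (quadraticBranchPlusEtaLowerInclusionAt_of_namedFacts_of_selmerWitness h22 h41 hKO hmod W C hCV
      hsurj hLW hwit)

/-- **(E⁺_η) at a tower-onto rank-zero pair, `Ш`-SHAPE** — the witness in the OUTPUT SHAPE of Kim's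
Thm. 1.8 (6) (`Kim2022_rankZero_padicValRat_sha_of_kuriharaNumber_ne_zero_of_maninConstant`):
«`L(W,1)/Ω_W = q`, `v_p(q) ≤ ord_p #Ш(W)(p)`», plus GZK (`hGZK`: in analytic rank `0`, `W(ℚ)` and
`Ш(W)` are finite, so `#Sel_{p^∞}(W/ℚ) = #Ш(W)[p^∞]`, tree
`natCard_selmerGroupPInfty_eq_natCard_primaryComponent_sha`). CONDITIONAL; closes nothing class-wide.
[cite: Kobayashi2003, §4 + Thm. 4.1 (p. 8), Thm. 9.3 (p. 26)] [cite: Kim2022StructureSelmer, Thm. 1.9 (6) (PDF pp. 7–8)]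
[cite: GreenbergLNM1716, §1 p. 54 (Sel and Ш in rank 0)] -/
theorem quadraticBranchPlusEtaLowerInclusionAt_of_namedFacts_of_shaWitness
    (h22 : Kobayashi2003.thm22_etaSignedSelmerDual_finite_torsion)
    (h41 : Kobayashi2003.thm41_plusEtaCharIdeal_dvd)
    (hKO : KitajimaOtsuki2018.mainThm13_etaSignedSelmerDual_noFiniteSubmodule)
    (hmod : hasEntireLFunction_rat) (hGZK : rank_eq_analyticRank_of_analyticRank_le_one)
    (W : WeierstrassCurve ℚ) [W.IsElliptic] [W.IsGloballyMinimal] (C : VariableChange ℚ)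
    (hCV : C • W.quadraticTwist ((-1) ^ (p / 2) * p) = V)
    (hsurj : ∀ m : ℕ, V.HasSurjectiveModNGaloisRep (p ^ m : ℕ))
    (hLW : W.entireLFunction 1 ≠ 0)
    (hwit : ∃ q : ℚ, W.entireLFunction 1 / (W.realPeriodRat : ℂ) = (q : ℂ) ∧
      padicValRat p q ≤ (padicValNat p (Nat.card (AddCommGroup.primaryComponent W.sha p)) : ℤ)) :
    QuadraticBranchPlusEtaLowerInclusionAt V p := by
  obtain ⟨q, hq, hqle⟩ := hwit
  obtain ⟨-, hE, -, -⟩ := Wuthrich2014.shaAn_eq_of_L_one_div_eq hGZK W hLW hq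
  haveI := hE
  refine quadraticBranchPlusEtaLowerInclusionAt_of_namedFacts_of_selmerWitness h22 h41 hKO hmod W C
    hCV hsurj hLW ⟨q, hq, ?_⟩
  rw [W.natCard_selmerGroupPInfty_eq_natCard_primaryComponent_sha p]
  exact hqle

end Pair

end Summit.BirchSwinnertonDyer.BirchSwinnertonDyer.Theorems

end
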